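import Literature.Geometry.Lorentzian.FlatQuietCollarExclusion
import Summits.FinalStateConjecture.FinalStateConjecture.Theorems.PhotonSphereChannelsTameCensorshipKerrKretschmann
import Summits.FinalStateConjecture.FinalStateConjecture.Theorems.PhotonSphereChannelsTameHullDefs
import Summits.FinalStateConjecture.FinalStateConjecture.Theorems.PhotonSphereChannelsChannelsResolveTameDevelopmentsRTrappedSetMinkowskiLimit
import Summits.FinalStateConjecture.FinalStateConjecture.Theorems.UniversalWitnessFamily.Negative.MinkowskiSettled
import HarnessLib

/-!
# Hypothesis (i) of K2R ≡ Φ — NO EXTREMAL REMNANT — holds at the Minkowski development; hence every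
# analytic hypothesis of Φ and its conclusion hold together at one certified vacuum Cauchy development
# (support for crux `ChannelsResolveTameDevelopmentsR`, item `stmt-FinalStateConjecture-14075`, route
# PhotonSphereChannels)

K2R is `K1R → Φ` with `K1R` a theorem of the tree, so K2R ≡ Φ: every MAXIMAL vacuum Cauchy development
of admissible data with COMPLETE `𝓘⁺`, (i) no late-time chart from a boosted EXTREMAL Kerr exterior along
which the near-zone `C²` deviation tends to `0` (`TameHull.NoExtremalRemnant`, verbatim the route decl's
clause), and (ii) tame outer region (`TameHull.TameOuter`) admits an honest exhaustive final-state
`2`-decomposition. The lead's report records that (i) "as typed is consumed by no line"; the K3 seats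
found the SAME clause over-strong in the generic statement (time reversal ∈ `lorentzGroup`). This file
certifies, kernel-checked, that (i) is nevertheless SATISFIABLE together with everything else Φ asks,
at the model point:

* `minkowski_noExtremalRemnant` — **Minkowski space has no extremal remnant**: no smooth chart `Ψ` from a
  boosted extremal Kerr exterior `{r > r₊ = M}` (any `Λ ∈ lorentzGroup`, any centre `c`, `|a| = M > 0`)
  into `(ℝ⁴, η)` has `C²` near-zone deviation `truncDeviationCk … Ψ 2 R τ → 0` for every `R`. PROOF:
  curvature. For extremal parameters the exterior `{r > r₊}` IS the star region `{r > M}`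
  (`rPlus_of_isExtremal`), so `boostedKerrBackground Λ c M a` with its clock shifted by `τ`
  (clock shift `⟨U, g₀, t* − τ, r⟩`) is LITERALLY the boosted Kerr star background with centre `c + τ Λ∂₀`
  (`clockShift_boostedKerrBackground_eq_starBackground`: the Poincaré map is affine and `g_{M,a}`, `r`
  are stationary, `KerrSchildChart.poincareInv_add_smul`, `Kerr.bilin_add_smul_basisVector_zero`,
  `Kerr.radius_add_time_smul_basisVector`); the near-zone deviation at chart time `τ` is the time-zero
  deviation of the shifted background (`truncDeviationCk_clockShift`); and the WINDOWED KRETSCHMANN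
  EXCLUSION of `FlatQuietCollarExclusion.lean` (`KerrWindow.minkowski_truncDeviationCk_gt_of_window`:
  the chart metric `Ψ^*η` is flat while `|Rm|²(g_{M,a}) = ¾M⁻⁴ > 0` at the equatorial slab point
  `r = 2M`, with `C²`-perturbation control) bounds that deviation below by `δ₀(M, Λ) > 0` at EVERY chart
  time — incompatible with `→ 0` at radius `R = 3M`. The closed form of the Kretschmann scalar of Kerr,
  a named fact in `FlatQuietCollarExclusion`, is DISCHARGED by the landed theorem
  `TameCensorshipCrush.stub_factKerrKretschmann` (ingoing Kerr coordinates + density), so the result is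
  unconditional.
* `minkowski_tameOuter` — (ii) holds at Minkowski space (translated identity charts of a coordinate ball,
  deviation `0`; `TrappedSet.isLateChart_minkowski_translate`).
* `minkowski_devHyp_of_isMaximal` — hence all four standing hypotheses `TameHull.DevHyp` of Φ hold at the
  Minkowski development as soon as it is maximal (the one uncertifiable clause, Choquet-Bruhat–Geroch);
* `tameResolution_instantiated_at_minkowski` — complete `𝓘⁺` ∧ (i) ∧ (ii) ∧ Φ's CONCLUSION (honest
  exhaustive `N = 0` decomposition, `UniversalWitnessFamily.Negative.settledIn_minkowski`) hold together at
  ONE certified vacuum Cauchy development of an admissible datum: Φ's hypothesis block is consistent with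
  its conclusion and no clause of it is junk at the dispersal end. Together with the slab certificate
  (`Negative/SlabMinkowski*`: (i), (ii) hold, `𝓘⁺` incomplete, no decomposition) this completes the
  model-class census of K2R's clauses.

## References

* M. Visser, *The Kerr spacetime: a brief introduction*, arXiv:0706.0622, §3 (Kretschmann scalar).
* M. Dafermos, G. Holzegel, I. Rodnianski, M. Taylor, arXiv:2104.08222, §1 (near-Kerr charts, deviations).
* R. P. Kerr, A. Schild (1965), §2 (stationarity and Lorentz covariance of the Kerr–Schild form).
* B. O'Neill, *Semi-Riemannian geometry* (1983), Ch. 3 (flatness of pulled-back flat metrics).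
-/

noncomputable section

set_option linter.dupNamespace false

open Set Filter Function TopologicalSpace Metric
open scoped Manifold ContDiff Topology ENNReal NNReal

namespace Summit.FinalStateConjecture.FinalStateConjecture.Theorems.ChannelsResolveTameDevelopmentsR.MinkowskiModel

open Literature.Geometry.Lorentzian
open Summit.FinalStateConjecture.FinalStateConjecture.Theorems.TameHull
  (NoExtremalRemnant outerRegion TameOuter DevHyp)

/-! ### Backgrounds with a shifted clock -/

/-- **Shifting the clock of a background shifts the slab times of near-zone deviations**: for the
background `⟨U, g₀, t − τ, r⟩` (same coordinate domain, reference form and radius as `B`, time function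
`t − τ`) the truncated `Cᵏ` deviation of a chart at chart time `σ` is that of `B` at time `σ + τ` (the
truncated slabs agree as subsets of `U`, the deviation field does not see the clock). -/
theorem truncDeviationCk_clockShift (𝓢 : Spacetime 4) (B : ModelBackground) (τ : ℝ)
    (Ψ : B.domain → 𝓢.carrier) (k : ℕ) (R σ : ℝ) :
    𝓢.truncDeviationCk (⟨B.domain, B.bilin, fun x ↦ B.time x - τ, B.radius⟩ : ModelBackground) Ψ k R σ =
      𝓢.truncDeviationCk B Ψ k R (σ + τ) := by
  have hslab : (⟨B.domain, B.bilin, fun x ↦ B.time x - τ, B.radius⟩ : ModelBackground).truncTimeSlab R σ =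
      B.truncTimeSlab R (σ + τ) := by
    ext x
    change (B.time x.1 - τ = σ ∧ B.radius x.1 ≤ R) ↔ (B.time x.1 = σ + τ ∧ B.radius x.1 ≤ R)
    rw [sub_eq_iff_eq_add]
  unfold Spacetime.truncDeviationCk
  rw [hslab]
  rfl

/-! ### Extremal parameters: the exterior is the star region; shifting the centre shifts the clock -/

/-- For extremal parameters `|a| = M > 0` the outer horizon radius is `r₊ = M`. -/
theorem rPlus_of_isExtremal {M a : ℝ} (h : Kerr.IsExtremal M a) : Kerr.rPlus M a = M := by
  obtain ⟨haM, -⟩ := h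
  unfold Kerr.rPlus
  rw [← haM, sq_abs, sub_self, Real.sqrt_zero, add_zero]

/-- Moving the centre along the Killing orbit `Λ∂₀` shifts the rest-frame coordinates back in time:
`Λ⁻¹(x − (c + τΛ∂₀)) = Λ⁻¹(x − c) − τ∂₀`. -/
theorem poincareInv_centre_add_smul (Λ : lorentzGroup) (c x : E4) (τ : ℝ) :
    poincareInv Λ (c + τ • (Λ : E4 ≃L[ℝ] E4) (EuclideanSpace.single (0 : Fin 4) (1 : ℝ))) x =
      poincareInv Λ c x + (-τ) • E4.basisVector 0 := by
  rw [← KerrSchildChart.poincareInv_add_smul Λ c x (-τ)]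
  simp only [poincareInv]
  congr 1
  rw [neg_smul]
  abel

/-- **For extremal parameters, the boosted Kerr background with clock shifted by `τ` is the boosted Kerr
STAR background with centre moved by `τΛ∂₀`** (same domain `{r > M}` since `r₊ = M` and `r` is
stationary, same form by stationarity of `g_{M,a}`, clock `t* − τ`, same radius). -/
theorem clockShift_boostedKerrBackground_eq_starBackground {M a : ℝ} (hMa : Kerr.IsExtremal M a)
    (Λ : lorentzGroup) (c : E4) (τ : ℝ) :
    (⟨(boostedKerrBackground Λ c M a).domain, (boostedKerrBackground Λ c M a).bilin,
        fun x ↦ (boostedKerrBackground Λ c M a).time x - τ,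
        (boostedKerrBackground Λ c M a).radius⟩ : ModelBackground) =
      starBackground Λ (c + τ • (Λ : E4 ≃L[ℝ] E4) (EuclideanSpace.single (0 : Fin 4) (1 : ℝ))) M a
        (fun x ↦ Kerr.radius a (poincareInv Λ
          (c + τ • (Λ : E4 ≃L[ℝ] E4) (EuclideanSpace.single (0 : Fin 4) (1 : ℝ))) x)) := by
  set c' : E4 := c + τ • (Λ : E4 ≃L[ℝ] E4) (EuclideanSpace.single (0 : Fin 4) (1 : ℝ)) with hc'
  have hr : Kerr.rPlus M a = M := rPlus_of_isExtremal hMa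
  have hP : ∀ x, poincareInv Λ c' x = poincareInv Λ c x + (-τ) • E4.basisVector 0 :=
    fun x ↦ poincareInv_centre_add_smul Λ c x τ
  have hdom : (boostedKerrBackground Λ c M a).domain =
      (starBackground Λ c' M a (fun x ↦ Kerr.radius a (poincareInv Λ c' x))).domain := by
    refine TopologicalSpace.Opens.ext (Set.ext fun x ↦ ?_)
    change x ∈ boostedKerrExterior Λ c M a ↔ poincareInv Λ c' x ∈ Kerr.region a M
    rw [mem_boostedKerrExterior, Kerr.mem_exterior, Kerr.mem_region, hr, hP,
      Kerr.radius_add_time_smul_basisVector]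
  have hbil : (boostedKerrBackground Λ c M a).bilin = boostedKerrBilin Λ c' M a := by
    funext x
    change boostedKerrBilin Λ c M a x = boostedKerrBilin Λ c' M a x
    ext u w
    rw [boostedKerrBilin_apply, boostedKerrBilin_apply, hP, Kerr.bilin_add_smul_basisVector_zero]
  have htime : (fun x ↦ (boostedKerrBackground Λ c M a).time x - τ) = fun x ↦ poincareInv Λ c' x 0 := by
    funext x
    change poincareInv Λ c x 0 - τ = poincareInv Λ c' x 0
    rw [hP, sub_eq_add_neg]
    simp
  have hrad : (boostedKerrBackground Λ c M a).radius = fun x ↦ Kerr.radius a (poincareInv Λ c' x) := by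
    funext x
    change Kerr.radius a (poincareInv Λ c x) = Kerr.radius a (poincareInv Λ c' x)
    rw [hP, Kerr.radius_add_time_smul_basisVector]
  rw [hdom, hbil, htime, hrad]
  rfl

/-! ### (i) at the model point -/

/-- **MINKOWSKI SPACE HAS NO EXTREMAL REMNANT** — hypothesis (i) of K2R / Φ (`TameHull.NoExtremalRemnant`,
verbatim the route decl's clause) holds at `Minkowski.vacuumCauchyDevelopment`: for `|a| = M > 0`, any
`Λ`, `c`, no smooth chart from the boosted extremal Kerr exterior into `(ℝ⁴, η)` has near-zone `C²`
deviation tending to `0` on the slabs `{t* = τ, r ≤ R}` for every `R`. At radius `R = 3M` the deviation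
is bounded below, at every chart time, by the windowed Kretschmann constant `δ₀(M, Λ) > 0` of flat space
(`KerrWindow.minkowski_truncDeviationCk_gt_of_window`, applied to the clock-shifted background, which is a
boosted Kerr star background; Kretschmann closed form discharged by `stub_factKerrKretschmann`).
[cite: arXiv07060622, §3] -/
theorem minkowski_noExtremalRemnant : NoExtremalRemnant Minkowski.vacuumCauchyDevelopment := by
  rintro Λ c M a hMa ⟨τ₀, Ψ, hΨ, hT⟩
  have hM : 0 < M := hMa.2
  have haM : |a| ≤ M := hMa.1.le
  -- label window and boost bound for the one label `(M, a)` and the one boost `Λ`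
  set m₀ : ℝ := min M M⁻¹ with hm₀
  have hm₀pos : 0 < m₀ := lt_min hM (inv_pos.2 hM)
  have hlo : m₀ ≤ M := min_le_left _ _
  have hhi : M ≤ m₀⁻¹ := by
    rw [le_inv_comm₀ hM hm₀pos]
    exact min_le_right _ _
  set ρ₀ : ℝ := max ‖((Λ : E4 ≃L[ℝ] E4) : E4 →L[ℝ] E4)‖ ‖((Λ : E4 ≃L[ℝ] E4).symm : E4 →L[ℝ] E4)‖
    with hρ₀
  obtain ⟨δ₀, hδ₀, H⟩ := KerrWindow.minkowski_truncDeviationCk_gt_of_window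
    (fun M a x hx ↦ PhotonSphereChannels.TameCensorshipCrush.stub_factKerrKretschmann M a x hx) hm₀pos ρ₀
  -- a chart time at which the near-zone deviation of radius `3M` is below `δ₀`
  have hev : ∀ᶠ τ in atTop, Minkowski.vacuumCauchyDevelopment.toSpacetime.truncDeviationCk
      (boostedKerrBackground Λ c M a) Ψ 2 (3 * M) τ < ENNReal.ofReal δ₀ :=
    (hT (3 * M)).eventually (gt_mem_nhds (ENNReal.ofReal_pos.2 hδ₀))
  obtain ⟨τ, hτ⟩ := hev.exists
  -- the clock-shifted background is a windowed, bounded-boost star background; the chart is smooth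
  have hB := clockShift_boostedKerrBackground_eq_starBackground hMa Λ c τ
  have hgt := H M a Λ _
    (⟨(boostedKerrBackground Λ c M a).domain, (boostedKerrBackground Λ c M a).bilin,
      fun x ↦ (boostedKerrBackground Λ c M a).time x - τ, (boostedKerrBackground Λ c M a).radius⟩ :
      ModelBackground)
    Ψ hlo hhi haM (le_max_left _ _) (le_max_right _ _) hB hΨ.contMDiff.contMDiffOn
  rw [truncDeviationCk_clockShift, zero_add] at hgt
  exact lt_asymm hτ hgt

/-! ### (ii) at the model point -/

/-- **Minkowski space is tame** — hypothesis (ii) of K2R / Φ (`TameHull.TameOuter`) holds at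
`Minkowski.vacuumCauchyDevelopment`, with radius `1` and `C³` bound `0`: about every point `q` the
translated identity chart `x ↦ q + x` of the unit coordinate ball is a late-time chart with deviation
`Ψ^*η − η = 0` (`TrappedSet.isLateChart_minkowski_translate`, `TrappedSet.deviationExtend_minkowski_translate`).
[folklore] -/
theorem minkowski_tameOuter : TameOuter Minkowski.vacuumCauchyDevelopment := by
  intro _inst
  refine ⟨1, one_pos, 0, fun q _ ↦ ?_⟩
  change E4 at q
  set U : Opens E4 := ⟨Metric.ball (0 : E4) 1, Metric.isOpen_ball⟩
  refine ⟨fun y : U ↦ q + (y : E4), TrappedSet.isLateChart_minkowski_translate 1 q,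
    ⟨⟨0, Metric.mem_ball_self one_pos⟩, rfl, by simp⟩, ?_, ?_⟩
  · change supCkENorm (U : Set E4) 3
      (Minkowski.spacetime.deviationExtend (Minkowski.backgroundOn U) fun y : U ↦ q + (y : E4)) ≤ _
    rw [TrappedSet.deviationExtend_minkowski_translate, supCkENorm_zero]
    exact zero_le
  · change supCkENorm (U : Set E4) 0
      (Minkowski.spacetime.deviationExtend (Minkowski.backgroundOn U) fun y : U ↦ q + (y : E4)) ≤ _
    rw [TrappedSet.deviationExtend_minkowski_translate, supCkENorm_zero]
    exact zero_le

/-! ### The package -/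

/-- **All four standing hypotheses of Φ hold at the Minkowski development once it is maximal**
(`TameHull.DevHyp`: MGHD — the hypothesis —, complete `𝓘⁺`
(`WeakCosmicCensorshipMGHD.Negative.minkowski_hasCompleteNullInfinity`), (i) `minkowski_noExtremalRemnant`,
(ii) `minkowski_tameOuter`). Maximality of `(ℝ⁴, η)` among the vacuum Cauchy developments of
`(ℝ³, δ, 0)` is the simplest case of Choquet-Bruhat–Geroch and is not certifiable in the tree.
[cite: ChoquetBruhatGeroch1969CMP, Thm. 3] -/
theorem minkowski_devHyp_of_isMaximal (hmax : Minkowski.vacuumCauchyDevelopment.IsMaximal) :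
    DevHyp Minkowski.vacuumCauchyDevelopment :=
  ⟨hmax, WeakCosmicCensorshipMGHD.Negative.minkowski_hasCompleteNullInfinity, minkowski_noExtremalRemnant,
    minkowski_tameOuter⟩

/-- **Φ INSTANTIATED AT THE MODEL POINT.** At the certified vacuum Cauchy development
`𝒟₀ = Minkowski.vacuumCauchyDevelopment` of the admissible trivial datum, every ANALYTIC hypothesis of
K2R ≡ Φ — complete `𝓘⁺` (sojourn form), (i) no extremal remnant, (ii) tame outer region — holds, AND so does
Φ's conclusion: an honest exhaustive final-state `2`-decomposition of the self-determined exterior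
(`N = 0`, `UniversalWitnessFamily.Negative.settledIn_minkowski`). So the hypothesis block of Φ is jointly
satisfiable, consistent with the conclusion, and (i) — the clause no line consumes — is not junk at the
dispersal end; compare the slab development (`Negative.SlabMinkowskiLoadBearing.slab_witness`: (i), (ii)
hold, `𝓘⁺` incomplete, NO decomposition). [cite: ChristodoulouKlainerman1993, Thm. 1.0.2] -/
theorem tameResolution_instantiated_at_minkowski :
    letI 𝒟 := Minkowski.vacuumCauchyDevelopment
    Summit.FinalStateConjecture.HasCompleteNullInfinity 𝒟.toCauchyDevelopment ∧
      NoExtremalRemnant 𝒟 ∧ TameOuter 𝒟 ∧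
        ∃ (O : Set 𝒟.carrier) (d : FinalStateDecomposition 𝒟.toSpacetime O 2),
          O = Summit.FinalStateConjecture.exteriorOf 𝒟.toCauchyDevelopment d.charted ∧
            Summit.FinalStateConjecture.HasExhaustiveCharts d := by
  obtain ⟨hscri, O, d, -, hO, hex⟩ := UniversalWitnessFamily.Negative.settledIn_minkowski
  exact ⟨hscri, minkowski_noExtremalRemnant, minkowski_tameOuter, O, d, hO, hex⟩

end Summit.FinalStateConjecture.FinalStateConjecture.Theorems.ChannelsResolveTameDevelopmentsR.MinkowskiModel

end
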